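import Literature.Geometry.Kaehler.ChartBallTransportDefectsCentre
import Literature.Geometry.Kaehler.L2InnerTransport
import Literature.NumberTheory.Transcendental.KaehlerHodgePreHilbert
import HarnessLib

/-!
# `L²` comparison between the central fibre and the nearby fibres of the Ehresmann chart-ball trivialisation
# (Voisin I §9.3.2, soft form — step (D) of the continuity of the harmonic projector family)

Layer `Literature/Geometry/Kaehler`; theorems only, no definition, no named fact.  Prover seat `hodge-nonav-19716-p2` (g11,
cell `hodge-nonav`): brick **K1-2** of prover-Bx's programme «GRIFFITHS-HOLOMORPHY» (design (b′) of 2026-08-29: «shrink the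
ball»), `--supports stmt-HodgeConjecture-19716`.  Setting of `ChartBallTransportDefectsCentre` (chart-ball data `Φ`, `e`, fibre
metrics `g b = (ι b)^* G`, `Φ (c s₀) = ι s₀`), plus an orientation field `o₀` of the central fibre `X s₀` with smooth volume form
and a positively oriented `g s₀`-orthonormal frame field `b`.

* **`exists_radius_re_cl2Inner_pullback_le`** — orientations `o z` of the fibres `X (c⁻¹ z)` transported from `o₀` along `e z`
  (compatible with `D(e z)`, smooth volume forms), and a radius `0 < r₁ ≤ r` such that for every `z ∈ ball (c s₀) r₁` and every
  smooth complex `k`-form `α` on `X (c⁻¹ z)`: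
  `Re (e_z^*ω, e_z^*ω)_{L²(X s₀)} ≤ 2 Re (ω, ω)_{L²(X (c⁻¹ z))}` and `Re (ω, ω)_{L²(X (c⁻¹ z))} ≤ 2 Re (e_z^*ω, e_z^*ω)_{L²(X s₀)}`
  — the diffeomorphisms `e z` are uniformly `L²`-bounded with uniformly `L²`-bounded inverses on the small ball.  Proof: by
  `eventually_transport_defects_le_centre` every `e z`, `z` near `c s₀`, is a `δ₀`-almost isometry of `(X s₀, g s₀)` for the
  threshold `δ₀` of `exists_forall_norm_cl2Inner_transport_sub_le` at `ε = 1/8`, whence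
  `|(ω, ω) − (e_z^*ω, e_z^*ω)| ≤ ½ Re (e_z^*ω, e_z^*ω)` (`(e_z⁻¹)^* e_z^* ω = ω`).

HONEST FRAMING: an analytic brick; nothing here says HC or any rung is proved.

## References
* [VoisinHodgeI2002] C. Voisin, Hodge Theory and Complex Algebraic Geometry I (2002), §5.1.1 eq. (5.1), §9.3.2 Prop. 9.20.
* [Warner1983] F. Warner, Foundations of Differentiable Manifolds and Lie Groups (1983), 4.8 (change of variables).
-/

noncomputable section

open scoped Manifold ContDiff Topology InnerProductSpace
open Bundle Module Set Filter Function Metric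
open Literature.Geometry.Manifold Literature.NumberTheory.Transcendental Literature.AlgebraicGeometry.Motives

namespace Literature.Geometry.Kaehler

-- The identification `TangentSpace I x = E` is an abuse of definitional equality; as in the tree's
-- tangent-bundle files we let `isDefEq` unfold it.
set_option backward.isDefEq.respectTransparency false

universe u

section ChartBall

variable {EX : Type u} [NormedAddCommGroup EX] [NormedSpace ℂ EX] [FiniteDimensional ℂ EX]
  [MeasurableSpace EX] [BorelSpace EX]
  {E𝒳 : Type u} [NormedAddCommGroup E𝒳] [NormedSpace ℂ E𝒳] [FiniteDimensional ℂ E𝒳]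
  {𝒳 : Type u} [TopologicalSpace 𝒳] [ChartedSpace E𝒳 𝒳] [IsManifold 𝓘(ℂ, E𝒳) ω 𝒳]
  [IsManifold 𝓘(ℝ, E𝒳) ∞ 𝒳]
  {EB : Type u} [NormedAddCommGroup EB] [NormedSpace ℂ EB]
  {B : Type u} [TopologicalSpace B] [ChartedSpace EB B]
  {proj : 𝒳 → B}
  (G : ContMDiffRiemannianMetric 𝓘(ℝ, E𝒳) ∞ E𝒳 (fun y : 𝒳 ↦ TangentSpace 𝓘(ℝ, E𝒳) y))
  {X : B → Type u} [∀ b, TopologicalSpace (X b)] [∀ b, ChartedSpace EX (X b)]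
  [∀ b, IsManifold 𝓘(ℂ, EX) ω (X b)] [∀ b, IsManifold 𝓘(ℝ, EX) ∞ (X b)]
  [∀ b, CompactSpace (X b)] [∀ b, T2Space (X b)]
  {ι : ∀ b, X b → 𝒳}

/-- **Uniform `L²` comparison between the central fibre and the nearby fibres** (step (D) of the continuity of the harmonic
projector family; see the module docstring).  [cite: VoisinHodgeI2002, §9.3.2 Prop. 9.20] [cite: Warner1983, 4.8] -/
theorem exists_radius_re_cl2Inner_pullback_le {O : Set B} (hι : ∀ b ∈ O, IsFibreEmbedding EX E𝒳 proj b (ι b))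
    (g : ∀ b, ContMDiffRiemannianMetric 𝓘(ℝ, EX) ∞ EX (fun x : X b ↦ TangentSpace 𝓘(ℝ, EX) x))
    (hg : ∀ b ∈ O, ∀ (x : X b) (v w : TangentSpace 𝓘(ℝ, EX) x), (g b).inner x v w =
      G.inner (ι b x) (mfderiv 𝓘(ℝ, EX) 𝓘(ℝ, E𝒳) (ι b) x v) (mfderiv 𝓘(ℝ, EX) 𝓘(ℝ, E𝒳) (ι b) x w))
    {s₀ : B} {r : ℝ} {Φ : EB → X s₀ → 𝒳}
    (hbO : ∀ p ∈ ball (extChartAt 𝓘(ℂ, EB) s₀ s₀) r, (extChartAt 𝓘(ℂ, EB) s₀).symm p ∈ O)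
    (hΦs : ContMDiffOn (𝓘(ℝ, EB).prod 𝓘(ℝ, EX)) 𝓘(ℝ, E𝒳) ∞ (uncurry Φ)
      (ball (extChartAt 𝓘(ℂ, EB) s₀ s₀) r ×ˢ univ))
    (e : ∀ p : EB, X s₀ ≃ₘ^∞⟮𝓘(ℝ, EX), 𝓘(ℝ, EX)⟯ X ((extChartAt 𝓘(ℂ, EB) s₀).symm p))
    (he : ∀ p ∈ ball (extChartAt 𝓘(ℂ, EB) s₀ s₀) r, ∀ x, ι ((extChartAt 𝓘(ℂ, EB) s₀).symm p) (e p x) = Φ p x)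
    (hs₀ : s₀ ∈ O) (hΦ0 : ∀ x, Φ (extChartAt 𝓘(ℂ, EB) s₀ s₀) x = ι s₀ x) (hr : 0 < r) {N : ℕ} [Fact (finrank ℝ EX = N)]
    (o₀ : (x : X s₀) → Orientation ℝ (TangentSpace 𝓘(ℝ, EX) x) (Fin N)) (k : ℕ) :
    letI : ∀ b', RiemannianBundle (fun x : X b' ↦ TangentSpace 𝓘(ℝ, EX) x) := fun b' ↦ ⟨(g b').toRiemannianMetric⟩
    IsSmoothForm (riemannianVolumeForm o₀) →
    ∀ (b : ∀ x : X s₀, OrthonormalBasis (Fin N) ℝ (TangentSpace 𝓘(ℝ, EX) x)), (∀ x, (b x).toBasis.orientation = o₀ x) →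
    ∃ o : ∀ z : EB, (y : X ((extChartAt 𝓘(ℂ, EB) s₀).symm z)) → Orientation ℝ (TangentSpace 𝓘(ℝ, EX) y) (Fin N),
      (∀ z x, Orientation.map (Fin N) ((e z).mfderivToContinuousLinearEquiv (by simp) x).toLinearEquiv (o₀ x) = o z (e z x)) ∧
      (∀ z, IsSmoothForm (riemannianVolumeForm (o z))) ∧
      ∃ r₁ : ℝ, 0 < r₁ ∧ r₁ ≤ r ∧ ∀ z ∈ ball (extChartAt 𝓘(ℂ, EB) s₀ s₀) r₁,
        ∀ (α₁ : MForm 𝓘(ℝ, EX) (X ((extChartAt 𝓘(ℂ, EB) s₀).symm z)) ℂ k), IsSmoothForm α₁ →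
          (MForm.cl2Inner o₀ (α₁.pullback 𝓘(ℝ, EX) (e z)) (α₁.pullback 𝓘(ℝ, EX) (e z))).re ≤
              2 * (MForm.cl2Inner (o z) α₁ α₁).re ∧
          (MForm.cl2Inner (o z) α₁ α₁).re ≤
              2 * (MForm.cl2Inner o₀ (α₁.pullback 𝓘(ℝ, EX) (e z)) (α₁.pullback 𝓘(ℝ, EX) (e z))).re := by
  letI iX : ∀ b', RiemannianBundle (fun x : X b' ↦ TangentSpace 𝓘(ℝ, EX) x) := fun b' ↦ ⟨(g b').toRiemannianMetric⟩
  intro ho₀ b hb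
  haveI : ∀ b', IsContMDiffRiemannianBundle 𝓘(ℝ, EX) ∞ EX (fun x : X b' ↦ TangentSpace 𝓘(ℝ, EX) x) :=
    fun b' ↦ ⟨(g b').inner, (g b').contMDiff, fun _ _ _ ↦ rfl⟩
  haveI : ∀ b', IsContinuousRiemannianBundle EX (fun x : X b' ↦ TangentSpace 𝓘(ℝ, EX) x) :=
    fun b' ↦ ⟨(g b').inner, (g b').contMDiff.continuous, fun _ _ _ ↦ rfl⟩
  -- ### orientations of the fibres, transported from `o₀` along `e z`
  have ho₀c : IsContinuousOrientation (I := 𝓘(ℝ, EX)) o₀ :=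
    isContinuousOrientation_of_isSmoothForm_riemannianVolumeForm_holds o₀ ho₀
  have hoex := fun z : EB ↦ exists_orientation_transport (n := N) (e z) o₀
  choose o hΦo hcompat using hoex
  have hoc : ∀ z, IsContinuousOrientation (I := 𝓘(ℝ, EX)) (o z) := fun z ↦
    isContinuousOrientation_of_orientationMap (o z) o₀ ho₀c (e z).symm.contMDiff (hcompat z)
  have ho : ∀ z, IsSmoothForm (riemannianVolumeForm (o z)) := fun z ↦
    isSmoothForm_riemannianVolumeForm_of_isContinuousOrientation_holds (o z) (hoc z)
  refine ⟨o, hΦo, ho, ?_⟩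
  -- ### the radius: every `e z`, `z` near `c s₀`, is a `δ₀`-almost isometry of `(X s₀, g s₀)`
  obtain ⟨δ₀, hδ₀, hR⟩ := exists_forall_norm_cl2Inner_transport_sub_le o₀ ho₀ b hb k (ε := 1 / 8) (by norm_num)
  have hev := eventually_transport_defects_le_centre G hι g hg hbO hΦs e he hs₀ hΦ0 hr hδ₀ b
  obtain ⟨r₁, hr₁, hball⟩ := Metric.eventually_nhds_iff_ball.1 hev
  refine ⟨min r₁ r, lt_min hr₁ hr, min_le_right _ _, fun z hz α₁ hω ↦ ?_⟩
  obtain ⟨hzD, hT, -⟩ := hball z (ball_subset_ball (min_le_left _ _) hz)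
  -- the transported form `a = e_z^* ω` on the central fibre, and `(e_z⁻¹)^* a = ω`
  set a : MForm 𝓘(ℝ, EX) (X s₀) ℂ k := α₁.pullback 𝓘(ℝ, EX) (e z) with ha
  have has : IsSmoothForm a := isSmoothForm_pullback (e z).contMDiff hω
  have hpb : a.pullback 𝓘(ℝ, EX) (e z).symm = α₁ := by
    rw [ha, ← MForm.pullback_comp ((e z).mdifferentiable (by simp)) ((e z).symm.mdifferentiable (by simp))]
    have : (((e z) : X s₀ → _) ∘ ((e z).symm : _ → X s₀)) = id := funext fun y ↦ (e z).apply_symm_apply y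
    rw [this, MForm.pullback_id]
  have key := hR (o z) (ho z) (e z) (hΦo z) hδ₀.le le_rfl (hT) has has
  rw [hpb] at key
  -- real parts
  set A := (MForm.cl2Inner o₀ a a).re with hA
  set Bz := (MForm.cl2Inner (o z) α₁ α₁).re with hBz
  have hA0 : 0 ≤ A := has.re_cl2Inner_self_nonneg o₀ ho₀
  have hdiff : |Bz - A| ≤ 2 * (1 / 8) * (A + A) := by
    have h1 : |Bz - A| = |(MForm.cl2Inner (o z) α₁ α₁ - MForm.cl2Inner o₀ a a).re| := by
      rw [Complex.sub_re]
    rw [h1]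
    exact (Complex.abs_re_le_norm _).trans key
  have h2 : |Bz - A| ≤ A / 2 := by linarith
  obtain ⟨h3, h4⟩ := abs_le.1 h2
  exact ⟨by linarith, by linarith⟩

end ChartBall

end Literature.Geometry.Kaehler

end
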